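import Summits.Ventures.PackingBounds.Configurations.ListConfig
import Summits.Ventures.PackingBounds.Configurations.SectionTransfer
import Summits.Ventures.PackingBounds.SphericalCodes.Dim6N27
import Summits.Ventures.PackingBounds.Energy.UniversalOptimality

/-!
# The 27-point sharp configuration on `S⁵` (`E₆`, Schläfli graph, `2₂₁`): `A(6, arccos 1/4) = 27` and the ground-state energy

Framing: lottery ticket; floor = certified bounds/negative ranges. Venture `PackingBounds` (cell
`pub-packcert`, seat `pub-packcert-energy`) — the **attained side** for `(n, N) = (6, 27)`.

`vecs` lists, in doubled `E₈` coordinates, the `27` vectors `3v - v₀ - v₁` where `v` runs over the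
`E₈` roots with `⟨v, v₀⟩ = ⟨v, v₁⟩ = 1` for two fixed roots with `⟨v₀, v₁⟩ = 1` (integers of squared
length `48`, orthogonal to `v₀` and to `2v₁ - v₀`): the minimal vectors of `E₆*` up to scale, i.e. the
vertices of the Gosset polytope `2₂₁` / the `27` lines on a cubic surface, with inner products
`-1/2, 1/4` of multiplicities `10, 16` (Cohn–Kumar's Table 1). The kernel checks the distance
distribution and the orthogonality; `Config.exists_section` moves the configuration to `ℝ⁶`. With the
cell's bounds: `A(6, arccos 1/4) = 27` (`IsGreatest`, with `SphericalCodes.code_dim6_le_27`) and the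
ground-state energy of `27` points on `S⁵` for every absolutely monotonic potential (`IsLeast`, with
`Energy.UniversalDim6Card27…`).

## References
* H. Cohn, A. Kumar, J. Amer. Math. Soc. 20 (2007) 99–148, Table 1. [`CohnKumar2006`]
* J. H. Conway, N. J. A. Sloane, *Sphere Packings, Lattices and Groups*, Ch. 4 §8.4 (`E₆`, `E₆*`). [`ConwaySloane1999`]
-/

namespace Summit.Ventures.PackingBounds.Config.Dim6Card27

open Finset Summit.Ventures.PackingBounds.Config

set_option maxHeartbeats 4000000 in
/-- The `27` vectors `3v - v₀ - v₁` (`v` an `E₈` root with `⟨v,v₀⟩ = ⟨v,v₁⟩ = 1`, doubled coordinates). [cite: ConwaySloane1999, Ch. 4 §8.4] -/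
def vecs : List (List ℤ) := [
  [2, -2, -2, 6, 0, 0, 0, 0],
  [2, -2, -2, -6, 0, 0, 0, 0],
  [2, -2, -2, 0, 6, 0, 0, 0],
  [2, -2, -2, 0, -6, 0, 0, 0],
  [2, -2, -2, 0, 0, 6, 0, 0],
  [2, -2, -2, 0, 0, -6, 0, 0],
  [2, -2, -2, 0, 0, 0, 6, 0],
  [2, -2, -2, 0, 0, 0, -6, 0],
  [2, -2, -2, 0, 0, 0, 0, 6],
  [2, -2, -2, 0, 0, 0, 0, -6],
  [-4, 4, 4, 0, 0, 0, 0, 0],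
  [-1, 1, 1, 3, 3, 3, 3, 3],
  [-1, 1, 1, 3, 3, 3, -3, -3],
  [-1, 1, 1, 3, 3, -3, 3, -3],
  [-1, 1, 1, 3, 3, -3, -3, 3],
  [-1, 1, 1, 3, -3, 3, 3, -3],
  [-1, 1, 1, 3, -3, 3, -3, 3],
  [-1, 1, 1, 3, -3, -3, 3, 3],
  [-1, 1, 1, 3, -3, -3, -3, -3],
  [-1, 1, 1, -3, 3, 3, 3, -3],
  [-1, 1, 1, -3, 3, 3, -3, 3],
  [-1, 1, 1, -3, 3, -3, 3, 3],
  [-1, 1, 1, -3, 3, -3, -3, -3],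
  [-1, 1, 1, -3, -3, 3, 3, 3],
  [-1, 1, 1, -3, -3, 3, -3, -3],
  [-1, 1, 1, -3, -3, -3, 3, -3],
  [-1, 1, 1, -3, -3, -3, -3, 3]]

/-- The distance table: dot products of a member with the other members, with multiplicities. -/
def table : List (ℤ × ℕ) := [(-24, 10), (12, 16)]

/-- Kernel check: `27` coordinate lists. -/
theorem length_vecs : vecs.length = 27 := by decide +kernel

set_option maxRecDepth 100000 in
/-- Kernel check: the coordinate lists are pairwise distinct. -/
private theorem nodup_vecs : vecs.Nodup := by decide +kernel

set_option maxRecDepth 100000 in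
/-- Kernel check: every list has length `8` and the prescribed squared length. -/
private theorem shape_vecs : shapeOK vecs 8 (48 : ℤ) = true := by decide +kernel

/-- Kernel check: the table keys are distinct and differ from the squared length. -/
private theorem keys_table : keysOK table (48 : ℤ) = true := by decide +kernel

set_option maxRecDepth 100000 in
/-- Kernel check (the distance distribution): the dot products of every member with the other members
have exactly the tabulated multiplicities and take no other value. -/
private theorem hist_vecs : histOK vecs table vecs = true := by decide +kernel


/-- The normal vectors cutting out the `6`-dimensional subspace containing the configuration
(pairwise orthogonal, nonzero). -/
def normals : List (List ℤ) := [
  [2, 2, 0, 0, 0, 0, 0, 0],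
  [2, -2, 4, 0, 0, 0, 0, 0]]

/-- Kernel check: the normals have length `8`, are nonzero and pairwise orthogonal. -/
private theorem normals_ok : normalsOK normals 8 = true := by decide +kernel

set_option maxRecDepth 100000 in
/-- Kernel check: every member of the configuration is orthogonal to every normal. -/
private theorem orth_ok : orthOK normals vecs = true := by decide +kernel

/-- `ι q > 0`. -/
private theorem hq : 0 < (Int.castRingHom ℝ) (48 : ℤ) := by simp

/-- **The configuration in `ℝ^6`**: `27` unit vectors of `ℝ^6` with pairwise inner products
`≤ 1 / 4` (the tabulated values) and, for every potential `a`, `a`-energy equal to the tabulated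
value (section of the ambient list configuration, moved to `ℝ^6` by `Config.exists_section`). -/
theorem exists_config : ∃ C : Finset (EuclideanSpace ℝ (Fin 6)), C.card = 27 ∧ (∀ x ∈ C, ‖x‖ = 1) ∧
    (∀ x ∈ C, ∀ y ∈ C, x ≠ y → inner ℝ x y ≤ 1 / 4) ∧
    ∀ a : ℝ → ℝ, ∑ x ∈ C, ∑ y ∈ C.erase x, a (inner ℝ x y) =
      (27 : ℝ) * (10 * a (-1 / 2) + 16 * a (1 / 4)) := by
  obtain ⟨C, hc, hn, hi, he⟩ := exists_section Int.cast_injective hq shape_vecs keys_table hist_vecs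
    nodup_vecs normals normals_ok orth_ok (n := 6) (by decide)
  refine ⟨C, by rw [hc, length_vecs], hn, fun x hx y hy hxy => ?_, fun a => ?_⟩
  · obtain ⟨p, hp, hpe⟩ := hi x hx y hy hxy
    rw [hpe]
    simp only [table, List.mem_cons, List.not_mem_nil, or_false] at hp
    rcases hp with rfl | rfl <;> norm_num
  · rw [he a, length_vecs]
    simp only [table, List.map_cons, List.map_nil, List.sum_cons, List.sum_nil, Nat.cast_ofNat]
    norm_num

/-- **Attained**: `27` unit vectors of `ℝ⁶` with pairwise inner products `≤ 1/4`. [cite: CohnKumar2006, Table 1] -/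
theorem exists_code_27 : ∃ C : Finset (EuclideanSpace ℝ (Fin 6)),
    C.card = 27 ∧ (∀ x ∈ C, ‖x‖ = 1) ∧ (∀ x ∈ C, ∀ y ∈ C, x ≠ y → inner ℝ x y ≤ 1 / 4) := by
  obtain ⟨C, hc, hn, hi, _⟩ := exists_config
  exact ⟨C, hc, hn, hi⟩

/-- **`A(6, arccos 1/4) = 27`** (two-sided: kernel-checked LP bound + this configuration). [cite: CohnKumar2006, Table 1] -/
theorem code_isGreatest : IsGreatest {N : ℕ | ∃ C : Finset (EuclideanSpace ℝ (Fin 6)), C.card = N ∧ (∀ x ∈ C, ‖x‖ = 1) ∧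
      (∀ x ∈ C, ∀ y ∈ C, x ≠ y → inner ℝ x y ≤ 1 / 4)} 27 := by
  refine ⟨exists_code_27, ?_⟩
  rintro N ⟨C, rfl, h1, h2⟩
  exact SphericalCodes.code_dim6_le_27 C h1 h2

/-- **Ground-state energy of `27` points on `S⁵`** for every absolutely monotonic potential (universal optimality lower bound + attained). [cite: CohnKumar2006, Theorem 1.2] -/
theorem energy_isLeast (a : ℝ → ℝ) (ha : AbsolutelyMonotoneOn a (Set.Ico (-1) 1)) :
    IsLeast {E : ℝ | ∃ C : Finset (EuclideanSpace ℝ (Fin 6)), (∀ x ∈ C, ‖x‖ = 1) ∧ C.card = 27 ∧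
      E = ∑ x ∈ C, ∑ y ∈ C.erase x, a (inner ℝ x y)}
      ((27 : ℝ) * (10 * a (-1 / 2) + 16 * a (1 / 4))) := by
  obtain ⟨C, hc, hn, _, he⟩ := exists_config
  refine ⟨⟨C, hn, hc, (he a).symm⟩, ?_⟩
  rintro E ⟨C', h1, hN, rfl⟩
  exact Energy.UniversalDim6Card27.universallyOptimal_of_absolutelyMonotoneOn a ha C' h1 hN

end Summit.Ventures.PackingBounds.Config.Dim6Card27
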